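import Summits.Ventures.PercRepro.GenQLargeGen

/-!
# PercRepro — THEOREM LARGE AT EVERY RANK, SHARPENED: the flats meet `G` in `≤ |G| − 1` points (night-4, gen 7)

`GenQLargeGen` bounds the non-spanning `j`-subsets of the rank-`q` set `G` through the rank-`(q − 1)` flats, whose
traces on `G` have `≤ f(q − 1)` points.  But a rank-`(q − 1)` flat never contains the rank-`q` set `G`: its trace has
`≤ |G| − 1` points (`card_inter_le_pred_of_flatsQ`).  Replacing `f(q − 1)` by `N = min(|G| − 1, f(q − 1))` in the
binomial ratio (`sum_flats_choose_le_gen'`) gives the sharper bound `lbSumQ'` and **`lbSumQ'_le_Jq`**, with the same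
proof.  The thresholds move (exact, `tools/lbsumq2.py`): `q = 6`: `d ≥ 13 / 16 / 19` (was `16 / 16 / 19`); `q = 7`:
`d ≥ 24 / 27 / 30 / 40` at `t = 3 / 4 / 5 / 6` (was `37 / 37 / 37 / 40`); `q = 8`: `46 / 48 / 52 / 63 / 83` (was
`80 / 80 / 80 / 80 / 83`).  Imports `GenQLargeGen`.
-/
namespace PercRepro.Night4

open Finset ThmH SixFour GenQ PerFlat Star

variable {α : Type} [DecidableEq α] {M : Matroid α} [M.Finite]

/-- A flat of rank `< q` meets the rank-`q` set `G` in `≤ |G| − 1` points. -/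
theorem card_inter_le_pred_of_flatsQ {q r : ℕ} (hr : r < q) {G F : Finset α}
    (hrG : M.eRk (G : Set α) = (q : ℕ∞)) (hF : F ∈ flatsQ M r) : (F ∩ G).card ≤ G.card - 1 := by
  have hF' := mem_flatsQ.1 hF
  have hne : F ∩ G ≠ G := by
    intro h
    have hsub : G ⊆ F := by
      intro x hx
      rw [← h] at hx
      exact (Finset.mem_inter.1 hx).1
    have := M.eRk_mono (Finset.coe_subset.2 hsub)
    rw [hrG, hF'.2.2] at this
    have : q ≤ r := by exact_mod_cast this
    omega
  have hlt : (F ∩ G).card < G.card :=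
    Finset.card_lt_card (Finset.ssubset_iff_subset_ne.2 ⟨Finset.inter_subset_right, hne⟩)
  omega

/-- **`C(N, k)·Σ_F C(|F ∩ G|, j) ≤ C(N, j)·C(|G|, k)`** with `N = min(|G| − 1, f(q − 1))`, `k = f(q − 2) + 1`,
`j > f(q − 2)`. -/
theorem sum_flats_choose_le_gen' {q : ℕ} {f : ℕ → ℕ} (hf : SizeChain M q f) (hq : 2 ≤ q) {G : Finset α}
    (hG : G ⊆ gr M) (hrG : M.eRk (G : Set α) = (q : ℕ∞)) {j : ℕ} (hj : f (q - 2) < j) :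
    (min (G.card - 1) (f (q - 1))).choose (f (q - 2) + 1) * ∑ F ∈ flatsQ M (q - 1), (F ∩ G).card.choose j ≤
      (min (G.card - 1) (f (q - 1))).choose j * G.card.choose (f (q - 2) + 1) := by
  calc (min (G.card - 1) (f (q - 1))).choose (f (q - 2) + 1) * ∑ F ∈ flatsQ M (q - 1), (F ∩ G).card.choose j
      = ∑ F ∈ flatsQ M (q - 1), (min (G.card - 1) (f (q - 1))).choose (f (q - 2) + 1) * (F ∩ G).card.choose j :=
        Finset.mul_sum _ _ _
    _ ≤ ∑ F ∈ flatsQ M (q - 1), (min (G.card - 1) (f (q - 1))).choose j * (F ∩ G).card.choose (f (q - 2) + 1) := by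
        apply Finset.sum_le_sum
        intro F hF
        have hF' := mem_flatsQ.1 hF
        have hFG : (F ∩ G).card ≤ f (q - 1) := by
          apply hf (F ∩ G) (Finset.inter_subset_right.trans hG) (q - 1) (by omega)
          rw [← hF'.2.2]
          exact M.eRk_mono (Finset.coe_subset.2 Finset.inter_subset_left)
        have hFG' := card_inter_le_pred_of_flatsQ (show q - 1 < q by omega) hrG hF
        exact choose_ratio_le_gen (le_min hFG' hFG) (by omega)
    _ = (min (G.card - 1) (f (q - 1))).choose j * ∑ F ∈ flatsQ M (q - 1), (F ∩ G).card.choose (f (q - 2) + 1) :=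
        (Finset.mul_sum _ _ _).symm
    _ ≤ (min (G.card - 1) (f (q - 1))).choose j * G.card.choose (f (q - 2) + 1) := by
        gcongr
        exact sum_flats_choose_k_le_gen hf hq hG

/-- `κ'_j = C(N, j)/C(N, k)` with `N = min(n − 1, f(q − 1))`, `k = f(q − 2) + 1`. -/
def kapQ' (q : ℕ) (f : ℕ → ℕ) (n j : ℕ) : ℚ :=
  ((min (n - 1) (f (q - 1))).choose j : ℚ) / ((min (n - 1) (f (q - 1))).choose (f (q - 2) + 1) : ℚ)

/-- The sharpened fiber bound: as `gLBQ`, with `κ'` in the middle branch (which also needs `k ≤ N`). -/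
def gLBQ' (q : ℕ) (f : ℕ → ℕ) (t n j : ℕ) : ℚ :=
  if j < q then 0
  else if f (q - 1) < j then (n.choose j : ℚ) * LwQ q f t j
  else if f (q - 2) < j ∧ f (q - 2) + 1 ≤ min (n - 1) (f (q - 1)) ∧ 0 ≤ LwQ q f t j then
    max ((n.choose j : ℚ) - kapQ' q f n j * (n.choose (f (q - 2) + 1) : ℚ)) 0 * LwQ q f t j
  else (n.choose j : ℚ) * min (LwQ q f t j) 0

/-- The sharpened explicit bound `lbSumQ' q f t n = Σ_{j ≤ n} gLBQ' q f t n j`. -/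
def lbSumQ' (q : ℕ) (f : ℕ → ℕ) (t n : ℕ) : ℚ := ∑ j ∈ Finset.range (n + 1), gLBQ' q f t n j

/-- The sharpened fiber bound: `gLBQ' q f t |G| j ≤ #{S ∈ R_q : |S| = j}·LwQ q f t j`. -/
theorem gLBQ'_le_fiber {q : ℕ} {f : ℕ → ℕ} (hf : SizeChain M q f) (hq : 2 ≤ q) {G : Finset α} (hG : G ⊆ gr M)
    (hrG : M.eRk (G : Set α) = (q : ℕ∞)) (t j : ℕ) :
    gLBQ' q f t G.card j ≤ (((Rq M G q).filter (fun S : Finset α => S.card = j)).card : ℚ) * LwQ q f t j := by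
  unfold gLBQ'
  split_ifs with hjq hfj hmid
  · rw [card_filter_Rq_eq_zero_of_lt_gen (M := M) G hjq]
    simp
  · rw [card_filter_Rq_eq_choose_gen hf (by omega) hG hrG hfj]
  · obtain ⟨hj2, hkN, hL⟩ := hmid
    apply mul_le_mul_of_nonneg_right _ hL
    apply max_le
    · have hA := choose_le_card_filter_Rq_add_gen hf hq hG hrG hj2
      have hB := sum_flats_choose_le_gen' hf hq hG hrG hj2
      have hpos : (0 : ℚ) < ((min (G.card - 1) (f (q - 1))).choose (f (q - 2) + 1) : ℚ) := by
        have : 0 < (min (G.card - 1) (f (q - 1))).choose (f (q - 2) + 1) := Nat.choose_pos hkN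
        exact_mod_cast this
      have hA' : (G.card.choose j : ℚ) ≤ (((Rq M G q).filter (fun S : Finset α => S.card = j)).card : ℚ) +
          ((∑ F ∈ flatsQ M (q - 1), (F ∩ G).card.choose j : ℕ) : ℚ) := by exact_mod_cast hA
      have hB' : ((min (G.card - 1) (f (q - 1))).choose (f (q - 2) + 1) : ℚ) *
          ((∑ F ∈ flatsQ M (q - 1), (F ∩ G).card.choose j : ℕ) : ℚ) ≤
          ((min (G.card - 1) (f (q - 1))).choose j : ℚ) * (G.card.choose (f (q - 2) + 1) : ℚ) := by
        exact_mod_cast hB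
      have hB'' : ((∑ F ∈ flatsQ M (q - 1), (F ∩ G).card.choose j : ℕ) : ℚ) ≤
          kapQ' q f G.card j * (G.card.choose (f (q - 2) + 1) : ℚ) := by
        unfold kapQ'
        rw [div_mul_eq_mul_div, le_div_iff₀ hpos]
        linarith
      linarith
    · positivity
  · have hc : (((Rq M G q).filter (fun S : Finset α => S.card = j)).card : ℚ) ≤ (G.card.choose j : ℚ) := by
      exact_mod_cast card_filter_Rq_le_choose_gen (M := M) G q j
    have hmin : min (LwQ q f t j) 0 ≤ 0 := min_le_right _ _
    have hmin' : min (LwQ q f t j) 0 ≤ LwQ q f t j := min_le_left _ _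
    have hf0 : (0 : ℚ) ≤ (((Rq M G q).filter (fun S : Finset α => S.card = j)).card : ℚ) := by positivity
    calc (G.card.choose j : ℚ) * min (LwQ q f t j) 0
        ≤ (((Rq M G q).filter (fun S : Finset α => S.card = j)).card : ℚ) * min (LwQ q f t j) 0 :=
          mul_le_mul_of_nonpos_right hc hmin
      _ ≤ (((Rq M G q).filter (fun S : Finset α => S.card = j)).card : ℚ) * LwQ q f t j :=
          mul_le_mul_of_nonneg_left hmin' hf0

/-- **THEOREM LARGE AT EVERY RANK, SHARPENED**: `lbSumQ' q f t |G| ≤ Jq M G q t` (`t ≤ q + 2`). -/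
theorem lbSumQ'_le_Jq (hs : Simple M) {q : ℕ} {f : ℕ → ℕ} (hf : SizeChain M q f) (hq : 2 ≤ q) {G : Finset α}
    (hG : G ⊆ gr M) (hrG : M.eRk (G : Set α) = (q : ℕ∞)) {t : ℕ} (ht : t ≤ q + 2) :
    lbSumQ' q f t G.card ≤ Jq M G q t := by
  calc lbSumQ' q f t G.card = ∑ j ∈ Finset.range (G.card + 1), gLBQ' q f t G.card j := rfl
    _ ≤ ∑ j ∈ Finset.range (G.card + 1),
        (((Rq M G q).filter (fun S : Finset α => S.card = j)).card : ℚ) * LwQ q f t j :=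
        Finset.sum_le_sum (fun j _ => gLBQ'_le_fiber hf hq hG hrG t j)
    _ = ∑ S ∈ Rq M G q, LwQ q f t S.card := (sum_LwQ_eq_fibers G q f t).symm
    _ ≤ ∑ S ∈ Rq M G q, (((q : ℚ) + 2 - t) * wInf M S - ((q : ℚ) + 2) / ((q : ℚ) + 1)) :=
        Finset.sum_le_sum (fun S hS => weight_ge_LwQ hs hf hq hG ht hS)
    _ ≤ Jq M G q t := Jq_ge_sum_weight_gen G q t

/-- **The large coranks from the sharpened numerics**: `0 ≤ lbSumQ' q f t |G|` gives `0 ≤ Jq M G q t`. -/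
theorem jq_nonneg_of_lbSumQ' (hs : Simple M) {q : ℕ} {f : ℕ → ℕ} (hf : SizeChain M q f) (hq : 2 ≤ q)
    {G : Finset α} (hG : G ⊆ gr M) (hrG : M.eRk (G : Set α) = (q : ℕ∞)) {t : ℕ} (ht : t ≤ q + 2)
    (hnum : 0 ≤ lbSumQ' q f t G.card) : 0 ≤ Jq M G q t :=
  hnum.trans (lbSumQ'_le_Jq hs hf hq hG hrG ht)

end PercRepro.Night4
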